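import Summits.Ventures.Crystal3D.Theorems.StickyWulffConstantCoaxialWallLawSeamReaderPiece
import HarnessLib

/-!
# CROSS MOVES DESCEND TO THE TARGET'S TWIN PIECE `coreOf Y b (G ∘ R_m)` (crux `CoaxialWallLaw`, stmt-Ventures-19481; line `WallLedgerF`, skeleton
# 'CoaxialWallLawCertificates' v8.1, stub `stub_incoherentSeamSmall`; F-TAIL-g12 §7 step 3)

HONEST FRAMING. Venture `Summits/Ventures/Crystal3D` (cell `crystal3d-full`); the cross-move companion of '…SeamReaderPiece': a CROSS-move (A)-end pair `(b, q)` of ANY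
configuration `Y` (reader `q` twin-reading in `(G, m)`, `⟪d, m⟫ = √(2/3)`, target `b = q − R_m d` in the mirrored class) is an (A)-end pair of the piece anchored AT
THE TARGET with the MIRRORED placement `G' = G.trans R_m`: `b`, the three mirror balls and `b`'s whole `G'`-dozen are `G'`-sites; `q = b + G' u` and its in-plane
hexagon are sites; `q`'s off-plane balls (lower triple, hence the predecessor `q − d`) are REFLECTED `G'`-positions at `q` and cap site triangles.  With
'…SeamReaderPiece' every (A)-pair of the word net descends to an exact piece (reader's or target's).  Nothing about the stubs is claimed; F-C1 not moved.
* `reflect_far_slot_mem_coreOf_at`, `reflect_slot_mem_coreOf_at` — '…SeamReaderPiece.reflect_(far_)slot_mem_coreOf' at a site point `p = c + S u₀` one slot off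
  the anchor (the capped triangle `{p, p + S(w − u'), p + S(w − u'')}` consists of sites);
* `isEndMove_cross_of_sites` — descent of a CROSS move under: `q`'s occupied `G`-dozen positions in `E`, `q`'s occupied reflected positions in `E`, `b`'s occupied
  `G'`-dozen positions in `E`;
* **`isEndPairA_targetPiece_of_cross`** — the cross-move pair is an (A)-end pair of `coreOf Y b (G.trans (ℝ ∙ m)ᗮ.reflection)`.
-/

noncomputable section

namespace Summit.Ventures.Crystal3D.Theorems

namespace TailResidue

open Summit.Ventures.Crystal3D Finset NearIdentity
open scoped InnerProductSpace

/-! ### Reflected positions at a site point one slot off the anchor -/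

/-- **A reflected far slot at a site point caps a site triangle**: `p = c + S u₀` (`u₀` a slot) in `Y`, `n` a unit menu normal of `S` whose in-plane hexagon around
`p` is occupied; then an occupied reflected position `p + (S w − 2⟪S w, n⟫ n)` of a far slot `w` lies in `coreOf Y c S`. -/
theorem reflect_far_slot_mem_coreOf_at {Y : Finset (EuclideanSpace ℝ (Fin 3))} {S : EuclideanSpace ℝ (Fin 3) ≃ₗᵢ[ℝ] EuclideanSpace ℝ (Fin 3)}
    {n c : EuclideanSpace ℝ (Fin 3)} {u₀ : EuclideanSpace ℝ (Fin 3)} (hu₀ : u₀ ∈ fccSlots) (hp : c + S u₀ ∈ Y) (hn1 : ‖n‖ = 1)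
    (hmenu : ∀ u ∈ fccSlots, ⟪S u, n⟫_ℝ = 0 ∨ ⟪S u, n⟫_ℝ = Real.sqrt (2 / 3) ∨ ⟪S u, n⟫_ℝ = -Real.sqrt (2 / 3))
    (hplane : ∀ u ∈ fccSlots, ⟪S u, n⟫_ℝ = 0 → c + S u₀ + S u ∈ Y) {w : EuclideanSpace ℝ (Fin 3)} (hw : w ∈ fccSlots) (hpos : 0 < ⟪S w, n⟫_ℝ)
    (hmem : c + S u₀ + (S w - (2 * ⟪S w, n⟫_ℝ) • n) ∈ Y) : c + S u₀ + (S w - (2 * ⟪S w, n⟫_ℝ) • n) ∈ coreOf Y c S := by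
  classical
  set p := c + S u₀ with hpdef
  obtain ⟨u₁, hu₁, u₂, hu₂, u₃, hu₃, hn₁, hn₂, hn₃, h12, h13, h23, -, huniq⟩ := exists_far_frame S hn1 hmenu
  obtain ⟨u', hu', u'', hu'', hn', hn'', hwu', hwu'', hu'u''⟩ : ∃ u' ∈ fccSlots, ∃ u'' ∈ fccSlots, ⟪S u', n⟫_ℝ = Real.sqrt (2 / 3) ∧
      ⟪S u'', n⟫_ℝ = Real.sqrt (2 / 3) ∧ ⟪w, u'⟫_ℝ = 1 / 2 ∧ ⟪w, u''⟫_ℝ = 1 / 2 ∧ ⟪u', u''⟫_ℝ = 1 / 2 := by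
    rcases huniq w hw hpos with rfl | rfl | rfl
    · exact ⟨u₂, hu₂, u₃, hu₃, hn₂, hn₃, h12, h13, h23⟩
    · exact ⟨u₁, hu₁, u₃, hu₃, hn₁, hn₃, by rw [real_inner_comm]; exact h12, h23, h13⟩
    · exact ⟨u₁, hu₁, u₂, hu₂, hn₁, hn₂, by rw [real_inner_comm]; exact h13, by rw [real_inner_comm]; exact h23, h12⟩
  have hwn : ⟪S w, n⟫_ℝ = Real.sqrt (2 / 3) := by
    rcases huniq w hw hpos with rfl | rfl | rfl
    · exact hn₁
    · exact hn₂
    · exact hn₃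
  have hh' : w - u' ∈ fccSlots := sub_mem_fccSlots_of_inner_eq_half hw hu' hwu'
  have hh'' : w - u'' ∈ fccSlots := sub_mem_fccSlots_of_inner_eq_half hw hu'' hwu''
  have hh'n : ⟪S (w - u'), n⟫_ℝ = 0 := by rw [map_sub, inner_sub_left, hwn, hn']; ring
  have hh''n : ⟪S (w - u''), n⟫_ℝ = 0 := by rw [map_sub, inner_sub_left, hwn, hn'']; ring
  have hpE : p ∈ coreOf Y c S := mem_coreOf_of_slot S hu₀ hp
  have hE' : p + S (w - u') ∈ coreOf Y c S := mem_coreOf_of_slot_add_slot S hu₀ hh' (hplane _ hh' hh'n)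
  have hE'' : p + S (w - u'') ∈ coreOf Y c S := mem_coreOf_of_slot_add_slot S hu₀ hh'' (hplane _ hh'' hh''n)
  set R := (ℝ ∙ n)ᗮ.reflection with hR
  have hx : S w - (2 * ⟪S w, n⟫_ℝ) • n = R (S w) := (reflection_unit_apply hn1 (S w)).symm
  have hRfix : ∀ {v : EuclideanSpace ℝ (Fin 3)}, ⟪S v, n⟫_ℝ = 0 → R (S v) = S v := fun hv =>
    Submodule.reflection_mem_subspace_eq_self (Submodule.mem_orthogonal_singleton_iff_inner_left.2 hv)
  have nw : ‖S w‖ = 1 := by rw [LinearIsometryEquiv.norm_map]; exact norm_eq_one_of_mem_fccSlots hw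
  have d0 : dist (p + R (S w)) p = 1 := by rw [dist_eq_norm, add_sub_cancel_left, LinearIsometryEquiv.norm_map, nw]
  have dside : ∀ {u : EuclideanSpace ℝ (Fin 3)}, u ∈ fccSlots → ⟪S (w - u), n⟫_ℝ = 0 → dist (p + R (S w)) (p + S (w - u)) = 1 := by
    intro u hu hun
    rw [dist_eq_norm, add_sub_add_left_eq_sub, ← hRfix hun, ← map_sub, LinearIsometryEquiv.norm_map, ← map_sub, LinearIsometryEquiv.norm_map,
      sub_sub_cancel]
    exact norm_eq_one_of_mem_fccSlots hu
  have d12 : dist (p + S (w - u')) (p + S (w - u'')) = 1 := by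
    rw [dist_eq_norm, add_sub_add_left_eq_sub, ← map_sub, LinearIsometryEquiv.norm_map, show w - u' - (w - u'') = u'' - u' by abel]
    exact norm_sub_eq_one_of_inner_half (norm_eq_one_of_mem_fccSlots hu'') (norm_eq_one_of_mem_fccSlots hu') (by rw [real_inner_comm]; exact hu'u'')
  have hcap : CapsTriangleIn (coreOf Y c S) (p + R (S w)) :=
    ⟨p, hpE, _, hE', _, hE'', dist_slotSite_eq_one S p hh', dist_slotSite_eq_one S p hh'', d12, d0, dside hu' hh'n, dside hu'' hh''n⟩
  have hcp : dist c p ≤ 1 := by rw [hpdef, dist_slotSite_eq_one S c hu₀]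
  rw [hx] at hmem ⊢
  refine mem_capClosure_of_capsTriangleIn (siteBallsAt_subset _ _ _) (mem_filter.2 ⟨hmem, ?_⟩) hcap
  have : dist c (p + R (S w)) ≤ dist c p + dist p (p + R (S w)) := dist_triangle _ _ _
  rw [dist_comm p, d0] at this
  linarith

/-- **Reflected positions at a site point one slot off the anchor lie in the piece** (any slot `w`; in-plane slots are sites). -/
theorem reflect_slot_mem_coreOf_at {Y : Finset (EuclideanSpace ℝ (Fin 3))} {S : EuclideanSpace ℝ (Fin 3) ≃ₗᵢ[ℝ] EuclideanSpace ℝ (Fin 3)}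
    {n c : EuclideanSpace ℝ (Fin 3)} {u₀ : EuclideanSpace ℝ (Fin 3)} (hu₀ : u₀ ∈ fccSlots) (hp : c + S u₀ ∈ Y) (hn : IsMenuNormal S n)
    (hplane : ∀ u ∈ fccSlots, ⟪S u, n⟫_ℝ = 0 → c + S u₀ + S u ∈ Y) {w : EuclideanSpace ℝ (Fin 3)} (hw : w ∈ fccSlots)
    (hmem : c + S u₀ + (S w - (2 * ⟪S w, n⟫_ℝ) • n) ∈ Y) : c + S u₀ + (S w - (2 * ⟪S w, n⟫_ℝ) • n) ∈ coreOf Y c S := by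
  obtain ⟨hn1, hmenu⟩ := hn
  rcases lt_trichotomy 0 ⟪S w, n⟫_ℝ with hpos | hzero | hneg
  · exact reflect_far_slot_mem_coreOf_at hu₀ hp hn1 hmenu hplane hw hpos hmem
  · have e : S w - (2 * ⟪S w, n⟫_ℝ) • n = S w := by rw [← hzero]; simp
    rw [e] at hmem ⊢
    exact mem_coreOf_of_slot_add_slot S hu₀ hw hmem
  · have hmenu' : ∀ u ∈ fccSlots, ⟪S u, -n⟫_ℝ = 0 ∨ ⟪S u, -n⟫_ℝ = Real.sqrt (2 / 3) ∨ ⟪S u, -n⟫_ℝ = -Real.sqrt (2 / 3) := by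
      intro u hu
      rcases hmenu u hu with h | h | h
      · exact Or.inl (by rw [inner_neg_right, h, neg_zero])
      · exact Or.inr (Or.inr (by rw [inner_neg_right, h]))
      · exact Or.inr (Or.inl (by rw [inner_neg_right, h, neg_neg]))
    have hplane' : ∀ u ∈ fccSlots, ⟪S u, -n⟫_ℝ = 0 → c + S u₀ + S u ∈ Y := fun u hu h => hplane u hu (by rw [inner_neg_right] at h; linarith)
    have e : S w - (2 * ⟪S w, n⟫_ℝ) • n = S w - (2 * ⟪S w, -n⟫_ℝ) • (-n) := by rw [inner_neg_right]; simp [smul_neg, neg_smul]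
    rw [e] at hmem ⊢
    exact reflect_far_slot_mem_coreOf_at hu₀ hp (by rw [norm_neg, hn1]) hmenu' hplane' hw (by rw [inner_neg_right]; linarith) hmem

/-! ### Cross moves descend -/

section Cross

variable {Y E : Finset (EuclideanSpace ℝ (Fin 3))} (hEY : E ⊆ Y)
  {G : EuclideanSpace ℝ (Fin 3) ≃ₗᵢ[ℝ] EuclideanSpace ℝ (Fin 3)} {q b d m : EuclideanSpace ℝ (Fin 3)} {v : WordVersion}

include hEY in
/-- **A CROSS move descends to `E ⊆ Y`** when `q`'s occupied `G`-dozen positions and occupied reflected positions (normal `m`) are in `E` and `b`'s occupied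
positions of the MIRRORED frame are in `E`. -/
theorem isEndMove_cross_of_sites (htw : IsTwinReading Y G m q) (hdm : ⟪d, m⟫_ℝ = Real.sqrt (2 / 3)) (hb : b = q - (d - (2 * ⟪d, m⟫_ℝ) • m))
    (hnm : ¬ IsMoving Y v (G.trans (ℝ ∙ m)ᗮ.reflection) (b - q) b)
    (hsq : ∀ w ∈ fccSlots, q + G w ∈ Y → q + G w ∈ E)
    (hmq : ∀ w ∈ fccSlots, q + (G w - (2 * ⟪G w, m⟫_ℝ) • m) ∈ Y → q + (G w - (2 * ⟪G w, m⟫_ℝ) • m) ∈ E)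
    (hsb' : ∀ w ∈ fccSlots, b + (G.trans (ℝ ∙ m)ᗮ.reflection) w ∈ Y → b + (G.trans (ℝ ∙ m)ᗮ.reflection) w ∈ E) :
    IsEndMove E v G d q b :=
  Or.inr ⟨m, isTwinReading_of_exact hEY htw hsq hmq, hdm, hb, fun hmov => hnm (isMoving_of_subset hEY hsb' hmov)⟩

end Cross

/-- **A CROSS-MOVE (A)-END PAIR IS AN (A)-END PAIR OF ITS TARGET'S TWIN PIECE.**  Data: admissible class `(G, d)`, predecessor `q − d ∈ Y`, `q` twin-reading in
`(G, m)` with `⟪d, m⟫ = √(2/3)`, target `b = q − R_m d` not moving in the mirrored class, two payers at `b`.  Conclusion: the pair is an (A)-end pair of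
`coreOf Y b (G.trans R_m)`. -/
theorem isEndPairA_targetPiece_of_cross {Y : Finset (EuclideanSpace ℝ (Fin 3))} (hY : ∀ p ∈ Y, ∀ p' ∈ Y, p ≠ p' → 1 ≤ dist p p')
    {v : WordVersion} {S₁ S₂ : PlateSystem} (h₁ : S₁.RT ⊆ fccSlots) (h₂ : S₂.RT ⊆ fccSlots)
    {G : EuclideanSpace ℝ (Fin 3) ≃ₗᵢ[ℝ] EuclideanSpace ℝ (Fin 3)} {q b d m : EuclideanSpace ℝ (Fin 3)} (hq : q ∈ Y) (hb : b ∈ Y) (hpay : HasTwoPayers Y b)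
    (hadm : S₁.Adm G d ∨ S₂.Adm G d) (hqd : q - d ∈ Y) (htw : IsTwinReading Y G m q) (hdm : ⟪d, m⟫_ℝ = Real.sqrt (2 / 3))
    (hbq : b = q - (d - (2 * ⟪d, m⟫_ℝ) • m)) (hnm : ¬ IsMoving Y v (G.trans (ℝ ∙ m)ᗮ.reflection) (b - q) b) :
    IsEndPairA (coreOf Y b (G.trans (ℝ ∙ m)ᗮ.reflection)) v S₁ S₂ b q := by
  classical
  set R := (ℝ ∙ m)ᗮ.reflection with hR
  set G' := G.trans R with hG'
  set E := coreOf Y b G' with hE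
  have hEY : E ⊆ Y := coreOf_subset Y b G'
  have hm1 : ‖m‖ = 1 := htw.1.1
  have hG'app : ∀ w, G' w = R (G w) := fun w => rfl
  have hRG' : ∀ w, R (G' w) = G w := fun w => by rw [hG'app, Submodule.reflection_reflection]
  have hRapp : ∀ x : EuclideanSpace ℝ (Fin 3), R x = x - (2 * ⟪x, m⟫_ℝ) • m := fun x => reflection_unit_apply hm1 x
  -- `m` is a menu normal of `G'` (values negate); in-plane for `G'` iff in-plane for `G`
  have hinn : ∀ w, ⟪G' w, m⟫_ℝ = -⟪G w, m⟫_ℝ := by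
    intro w
    rw [hG'app, hRapp, inner_sub_left, inner_smul_left, real_inner_self_eq_norm_sq, hm1]
    simp; ring
  have hn' : IsMenuNormal G' m := by
    refine ⟨hm1, fun w hw => ?_⟩
    rcases htw.1.2 w hw with h | h | h
    · exact Or.inl (by rw [hinn, h, neg_zero])
    · exact Or.inr (Or.inr (by rw [hinn, h]))
    · exact Or.inr (Or.inl (by rw [hinn, h, neg_neg]))
  -- `d` and `−d` are `G`-slots; `q = b + G' u`
  obtain ⟨⟨u, hu, hdu⟩, ⟨u', hu', hdu'⟩⟩ : (∃ u ∈ fccSlots, d = G u) ∧ (∃ u ∈ fccSlots, -d = G u) := by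
    rcases hadm with h | h
    · exact exists_slots_of_adm h₁ h
    · exact exists_slots_of_adm h₂ h
  have hqb : q = b + G' u := by
    rw [hbq, hG'app, hRapp, ← hdu]; abel
  have hqY' : b + G' u ∈ Y := hqb ▸ hq
  have hqE : q ∈ E := by rw [hqb]; exact mem_coreOf_of_slot G' hu hqY'
  have hbE : b ∈ E := mem_coreOf_self hb G'
  -- `q`'s in-plane hexagon (frame `G'`, = frame `G`) is occupied by the twin reading
  have hplane : ∀ w ∈ fccSlots, ⟪G' w, m⟫_ℝ = 0 → b + G' u + G' w ∈ Y := by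
    intro w hw h0
    have hG0 : ⟪G w, m⟫_ℝ = 0 := by rw [hinn] at h0; linarith
    have e : G' w = G w := by rw [hG'app]; exact Submodule.reflection_mem_subspace_eq_self (Submodule.mem_orthogonal_singleton_iff_inner_left.2 hG0)
    rw [← hqb, e]
    exact htw.2.1 w hw hG0.le
  -- `q`'s `G`-dozen positions: `q + G w = q + R (G' w)` is a reflected `G'`-position at `q`
  have hsq : ∀ w ∈ fccSlots, q + G w ∈ Y → q + G w ∈ E := by
    intro w hw hmem
    have e : q + G w = b + G' u + (G' w - (2 * ⟪G' w, m⟫_ℝ) • m) := by rw [← hRapp, hRG', hqb]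
    rw [e] at hmem ⊢
    exact reflect_slot_mem_coreOf_at hu hqY' hn' hplane hw hmem
  -- `q`'s reflected positions are `G'`-sites
  have hmq : ∀ w ∈ fccSlots, q + (G w - (2 * ⟪G w, m⟫_ℝ) • m) ∈ Y → q + (G w - (2 * ⟪G w, m⟫_ℝ) • m) ∈ E := by
    intro w hw hmem
    have e : q + (G w - (2 * ⟪G w, m⟫_ℝ) • m) = b + G' u + G' w := by rw [← hRapp, ← hG'app, hqb]
    rw [e] at hmem ⊢
    exact mem_coreOf_of_slot_add_slot G' hu hw hmem
  -- `b`'s `G'`-dozen positions are sites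
  have hsb' : ∀ w ∈ fccSlots, b + G' w ∈ Y → b + G' w ∈ E := fun w hw hmem => mem_coreOf_of_slot G' hw hmem
  -- the predecessor `q − d = q + G u'` (a lower slot: reflected `G'`-position at `q`)
  have hqdE : q - d ∈ E := by
    have e : q - d = q + G u' := by rw [sub_eq_add_neg, hdu']
    rw [e] at hqd ⊢
    exact hsq u' hu' hqd
  refine ⟨hqE, hbE, ?_, G, d, hadm, hqdE, isEndMove_cross_of_sites hEY htw hdm hbq hnm hsq hmq hsb'⟩
  -- two payers in `E`
  have hdeg : ∀ y, (E.filter fun p => dist y p = 1).card ≤ (Y.filter fun p => dist y p = 1).card :=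
    fun y => card_le_card (fun p hp => by rw [mem_filter] at hp ⊢; exact ⟨hEY hp.1, hp.2⟩)
  rcases hpay with hle | ⟨z₁, hz₁, z₂, hz₂, hne, hd₁, hd₂, hdeg₁, hdeg₂⟩
  · exact Or.inl ((hdeg b).trans hle)
  · have drop : ∀ {w}, w ∈ Y → w ∉ E → dist b w = 1 → (E.filter fun p => dist b p = 1).card ≤ 11 := by
      intro w hw hwE hd
      have hwmem : w ∈ Y.filter fun p => dist b p = 1 := mem_filter.2 ⟨hw, hd⟩
      have hs : E.filter (fun p => dist b p = 1) ⊆ (Y.filter fun p => dist b p = 1).erase w := by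
        intro p hp; rw [mem_filter] at hp
        exact mem_erase.2 ⟨fun h => hwE (h ▸ hp.1), mem_filter.2 ⟨hEY hp.1, hp.2⟩⟩
      have h12 := card_filter_dist_eq_one_le_twelve Y hY b
      have hc := card_le_card hs
      rw [card_erase_of_mem hwmem] at hc
      omega
    by_cases hE₁ : z₁ ∈ E
    · by_cases hE₂ : z₂ ∈ E
      · exact Or.inr ⟨z₁, hE₁, z₂, hE₂, hne, hd₁, hd₂, (hdeg z₁).trans hdeg₁, (hdeg z₂).trans hdeg₂⟩
      · exact Or.inl (drop hz₂ hE₂ hd₂)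
    · exact Or.inl (drop hz₁ hE₁ hd₁)

end TailResidue

end Summit.Ventures.Crystal3D.Theorems

end
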